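import Mathlib
import Summits.MatrixMultiplication.MatrixMultiplication.Theses.AutomaticSTPPDesigns
import Literature.Combinatorics.Additive.TripleProductProperty
import Literature.Computability.AlgebraicComplexity.PrattTrapezoidValSTPP
import Literature.Computability.AutomaticStructures.AutomaticBlock

/-!
# `NontrivialAllScalesFamily` — a regular all-scales STPP family beating the host at mass `τ = 1`

Route `MatrixMultiplication/AutomaticSTPPDesigns`, item `stmt-MatrixMultiplication-7362` (support):
there are a base `p ≥ 2`, a finite index alphabet `ι` and three REGULAR languages over `ι × Fin p`
whose induced family of blocks (`Literature.Computability.AutomaticStructures.automaticBlock`, the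
`let blk := …` of the route) is an STPP family (CKSU 2005, Def. 5.1; the tree's
`AddSimultaneousTPP`) in `ℤ/(p^k)` at EVERY scale `k`, with total mass `∑_w |A_w||B_w||C_w| > p^k` at
infinitely many (here: all positive) scales.

## The construction (letterwise languages over one digit design)

* **Digit designs lift to all scales** (`allScales_of_digitDesign`). Let `(D^A_i, D^B_i, D^C_i)_{i ∈ ι}`
  be digit sets `⊆ Fin p` forming an STPP family in the cyclic group `ℤ/p`, of mass
  `m = ∑ᵢ |D^A_i||D^B_i||D^C_i|`. The *letterwise* language `L_A = {x : every letter (i, d) of x has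
  d ∈ D^A_i}` is regular (a two-state automaton, `isRegular_letterwise`), its block at the index word
  `w` is the digit box `∏_j D^A_{w_j}` read in base `p` (`automaticBlock_letterwise`), so the mass at
  scale `k` is `m^k` (`> p^k` as soon as `m > p` and `k ≥ 1`). The level-`k` family is STPP in
  `ℤ/(p^k)` by a CARRY INDUCTION (`digits_eq_of_pow_dvd`): an STPP relation
  `(s'-s)+(t'-t)+(u'-u) ≡ 0 (mod p^k)` between box elements reduces mod `p` to the digit-`0`
  relation, where the STPP of the digit design forces equal indices AND equal digits; hence the
  digit-`0` combination vanishes exactly, no carry is produced, and the relation divided by `p` is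
  the same relation for the tails mod `p^(k-1)`.
* **A digit design of mass `144 > 140` in `ℤ/140`** (`exists_digitDesign`): the two-triple example
  of Cohn–Kleinberg–Szegedy–Umans 2005, §5 (before Prop. 5.2/Lemma 5.4) in `H₁ × H₂ × H₃`,
  `A₀ = (H₁∖0) e₁, B₀ = (H₂∖0) e₂, C₀ = (H₃∖0) e₃`, `A₁ = B₀, B₁ = C₀, C₁ = A₀`
  (`addSimultaneousTPP_coordDesign`: in every mixed index pattern one coordinate receives exactly one
  non-zero contribution), instantiated in `ℤ/4 × ℤ/5 × ℤ/7` and transported to `ℤ/140` along the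
  Chinese remainder isomorphism (`ZMod.chineseRemainder`, sum-reflecting maps preserve the STPP:
  `Literature.Computability.AlgebraicComplexity.addSimultaneousTPP_image_of_reflect`). Mass
  `3·4·6 + 4·6·3 = 144`.

So `p = 140`, `ι = Fin 2`, and the regular tower certifies `140^k < 144^k` solutions at every
scale `k ≥ 1` (a machine-checkable regular STPP tower with `τ = 1`).

## References

* H. Cohn, R. Kleinberg, B. Szegedy, C. Umans, *Group-theoretic algorithms for matrix
  multiplication*, FOCS 2005, arXiv:math/0511460, Def. 5.1 and the example of §5.
* V. Bruyère, G. Hansel, C. Michaux, R. Villemaire, Bull. Belg. Math. Soc. 1 (1994), §5.1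
  (synchronous `p`-automata; the tree's `automaticBlock`).
-/

-- single-conjunct summit: the mandated namespace repeats `MatrixMultiplication`.
set_option linter.dupNamespace false

namespace Summit.MatrixMultiplication.MatrixMultiplication.Theorems

namespace NontrivialAllScalesFamily

open Finset Literature.Combinatorics.Additive Literature.Computability.AutomaticStructures

/-! ### The two-triple coordinate design of CKSU 2005, §5 -/

/-- **The two-triple STPP design of Cohn–Kleinberg–Szegedy–Umans 2005, §5** in a product
`H₁ × H₂ × H₃` of three abelian groups: `A₀ = {(x,0,0) : x ≠ 0}`, `B₀ = {(0,y,0) : y ≠ 0}`,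
`C₀ = {(0,0,z) : z ≠ 0}` and `A₁ = B₀`, `B₁ = C₀`, `C₁ = A₀` satisfy the simultaneous triple
product property. Proof: in the one-clause form, for each of the eight index patterns `(i,j,k)`
either `i = j = k` and the relation splits into the three coordinates, or some coordinate of the
relation consists of exactly one non-zero entry. [cite: CohnKleinbergSzegedyUmans2005, §5] -/
theorem addSimultaneousTPP_coordDesign {H₁ H₂ H₃ : Type*} [AddCommGroup H₁] [AddCommGroup H₂]
    [AddCommGroup H₃] [Fintype H₁] [Fintype H₂] [Fintype H₃] [DecidableEq H₁] [DecidableEq H₂]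
    [DecidableEq H₃] :
    AddSimultaneousTPP (G := H₁ × H₂ × H₃)
      ![(univ.erase 0).image fun x : H₁ => (x, (0 : H₂), (0 : H₃)),
        (univ.erase 0).image fun y : H₂ => ((0 : H₁), y, (0 : H₃))]
      ![(univ.erase 0).image fun y : H₂ => ((0 : H₁), y, (0 : H₃)),
        (univ.erase 0).image fun z : H₃ => ((0 : H₁), (0 : H₂), z)]
      ![(univ.erase 0).image fun z : H₃ => ((0 : H₁), (0 : H₂), z),
        (univ.erase 0).image fun x : H₁ => (x, (0 : H₂), (0 : H₃))] := by
  rw [addSimultaneousTPP_iff_forall]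
  intro i j k s hs s' hs' t ht t' ht' u hu u' hu' h0
  fin_cases i <;> fin_cases j <;> fin_cases k
  all_goals
    simp only [Fin.zero_eta, Fin.mk_one, Fin.isValue, Matrix.cons_val_zero, Matrix.cons_val_one,
      mem_image, mem_erase, mem_univ, ne_eq, and_true] at hs hs' ht ht' hu hu'
    obtain ⟨a, ha, rfl⟩ := hs
    obtain ⟨a', ha', rfl⟩ := hs'
    obtain ⟨b, hb, rfl⟩ := ht
    obtain ⟨b', hb', rfl⟩ := ht'
    obtain ⟨c, hc, rfl⟩ := hu
    obtain ⟨c', hc', rfl⟩ := hu'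
    simp only [Prod.mk_sub_mk, Prod.mk_add_mk, sub_zero, zero_sub, add_zero, zero_add,
      Prod.mk_eq_zero, sub_eq_zero, neg_eq_zero, neg_add_eq_zero, add_neg_eq_zero] at h0
    first
      | (obtain ⟨h1, h2, h3⟩ := h0; subst h1 h2 h3; exact ⟨rfl, rfl, rfl, rfl, rfl⟩)
      | (exfalso; simp_all)

/-! ### The carry induction: digit designs lift to every scale -/

/-- **Carry induction.** Let `(D^A_i, D^B_i, D^C_i)_i` be digit sets in `Fin p` whose images in
`ℤ/p` form an STPP family. If digit words `S ∈ ∏ D^A_{K_j}`, `S' ∈ ∏ D^A_{I_j}`, `T ∈ ∏ D^B_{I_j}`,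
`T' ∈ ∏ D^B_{J_j}`, `U ∈ ∏ D^C_{J_j}`, `U' ∈ ∏ D^C_{K_j}` satisfy
`p^k ∣ ∑_j ((S'_j - S_j) + (T'_j - T_j) + (U'_j - U_j)) p^j`, then `I = J = K`, `S = S'`, `T = T'`,
`U = U'`. Induction on `k`: the relation mod `p` is the digit-`0` STPP relation in `ℤ/p`, which
forces equal indices and equal digits at position `0`; the position-`0` combination then vanishes
exactly (no carry), and the relation divided by `p` is the statement for the tails. [folklore] -/
theorem digits_eq_of_pow_dvd {ι : Type*} {p : ℕ} [NeZero p] (DA DB DC : ι → Finset (Fin p))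
    (hD : AddSimultaneousTPP
      (fun i => (DA i).image fun d : Fin p => ((d : ℕ) : ZMod p))
      (fun i => (DB i).image fun d : Fin p => ((d : ℕ) : ZMod p))
      (fun i => (DC i).image fun d : Fin p => ((d : ℕ) : ZMod p))) :
    ∀ (k : ℕ) (I J K : Fin k → ι) (S S' T T' U U' : Fin k → Fin p),
      (∀ j, S j ∈ DA (K j)) → (∀ j, S' j ∈ DA (I j)) → (∀ j, T j ∈ DB (I j)) →
      (∀ j, T' j ∈ DB (J j)) → (∀ j, U j ∈ DC (J j)) → (∀ j, U' j ∈ DC (K j)) →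
      ((p : ℤ) ^ k ∣ ∑ j, stppDigit S S' T T' U U' j * (p : ℤ) ^ (j : ℕ)) →
      I = J ∧ J = K ∧ S = S' ∧ T = T' ∧ U = U' := by
  rw [addSimultaneousTPP_iff_forall] at hD
  have hinj : ∀ {a b : Fin p}, ((a : ℕ) : ZMod p) = ((b : ℕ) : ZMod p) → a = b := by
    intro a b h
    apply Fin.ext
    have h' := congrArg ZMod.val h
    rwa [ZMod.val_cast_of_lt a.is_lt, ZMod.val_cast_of_lt b.is_lt] at h'
  intro k
  induction k with
  | zero =>
    intro I J K S S' T T' U U' _ _ _ _ _ _ _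
    exact ⟨Subsingleton.elim _ _, Subsingleton.elim _ _, Subsingleton.elim _ _,
      Subsingleton.elim _ _, Subsingleton.elim _ _⟩
  | succ k ih =>
    intro I J K S S' T T' U U' hS hS' hT hT' hU hU' hdvd
    simp only [stppDigit] at hdvd
    have hsplit : ∑ j : Fin (k + 1), (((S' j : ℕ) : ℤ) - (S j : ℕ) + (((T' j : ℕ) : ℤ) - (T j : ℕ))
          + (((U' j : ℕ) : ℤ) - (U j : ℕ))) * (p : ℤ) ^ (j : ℕ)
        = ((((S' 0 : ℕ) : ℤ) - (S 0 : ℕ) + (((T' 0 : ℕ) : ℤ) - (T 0 : ℕ))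
            + (((U' 0 : ℕ) : ℤ) - (U 0 : ℕ)))
          + (p : ℤ) * ∑ j : Fin k, (((S' j.succ : ℕ) : ℤ) - (S j.succ : ℕ)
              + (((T' j.succ : ℕ) : ℤ) - (T j.succ : ℕ)) + (((U' j.succ : ℕ) : ℤ) - (U j.succ : ℕ)))
              * (p : ℤ) ^ (j : ℕ)) := by
      rw [Fin.sum_univ_succ, Finset.mul_sum]
      congr 1
      · simp
      · refine Finset.sum_congr rfl fun j _ => ?_
        rw [Fin.val_succ, pow_succ]
        ring
    rw [hsplit] at hdvd
    -- digit `0`: `p` divides the position-`0` combination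
    have hp0 : (p : ℤ) ∣ (((S' 0 : ℕ) : ℤ) - (S 0 : ℕ) + (((T' 0 : ℕ) : ℤ) - (T 0 : ℕ))
        + (((U' 0 : ℕ) : ℤ) - (U 0 : ℕ))) := by
      have h1 : (p : ℤ) ∣ (p : ℤ) ^ (k + 1) := dvd_pow_self _ (Nat.succ_ne_zero k)
      exact (dvd_add_left (dvd_mul_right _ _)).1 (h1.trans hdvd)
    have hz : ((S' 0 : ℕ) : ZMod p) - ((S 0 : ℕ) : ZMod p)
        + ((((T' 0 : ℕ)) : ZMod p) - ((T 0 : ℕ) : ZMod p))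
        + (((U' 0 : ℕ) : ZMod p) - ((U 0 : ℕ) : ZMod p)) = 0 := by
      have := (ZMod.intCast_zmod_eq_zero_iff_dvd _ p).2 hp0
      push_cast at this
      exact this
    obtain ⟨hIJ0, hJK0, hSS0, hTT0, hUU0⟩ := hD (I 0) (J 0) (K 0) _ (mem_image_of_mem _ (hS 0))
      _ (mem_image_of_mem _ (hS' 0)) _ (mem_image_of_mem _ (hT 0)) _ (mem_image_of_mem _ (hT' 0))
      _ (mem_image_of_mem _ (hU 0)) _ (mem_image_of_mem _ (hU' 0)) hz
    have hS0 : S 0 = S' 0 := hinj hSS0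
    have hT0 : T 0 = T' 0 := hinj hTT0
    have hU0 : U 0 = U' 0 := hinj hUU0
    -- no carry out of position `0`: the tails satisfy the relation mod `p^k`
    rw [hS0, hT0, hU0, sub_self, sub_self, sub_self, add_zero, add_zero, zero_add, pow_succ']
      at hdvd
    have htail := (mul_dvd_mul_iff_left (NeZero.ne (p : ℤ))).1 hdvd
    obtain ⟨hIJ, hJK, hSS, hTT, hUU⟩ := ih (fun j => I j.succ) (fun j => J j.succ)
      (fun j => K j.succ) (fun j => S j.succ) (fun j => S' j.succ) (fun j => T j.succ)
      (fun j => T' j.succ) (fun j => U j.succ) (fun j => U' j.succ) (fun j => hS _)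
      (fun j => hS' _) (fun j => hT _) (fun j => hT' _) (fun j => hU _) (fun j => hU' _) htail
    exact ⟨funext (Fin.cases hIJ0 (fun j => congrFun hIJ j)),
      funext (Fin.cases hJK0 (fun j => congrFun hJK j)),
      funext (Fin.cases hS0 (fun j => congrFun hSS j)),
      funext (Fin.cases hT0 (fun j => congrFun hTT j)),
      funext (Fin.cases hU0 (fun j => congrFun hUU j))⟩

/-! ### Letterwise languages: regularity and blocks -/

/-- **Membership in a letterwise language.** The two-state automaton (live state `true`, sink
`false`) which stays live as long as every letter `(i, d)` read has `d ∈ D i` accepts the word `x`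
iff all letters of `x` pass. [folklore] -/
theorem mem_accepts_letterwise {ι : Type*} {p : ℕ} (D : ι → Finset (Fin p))
    (x : List (ι × Fin p)) :
    x ∈ (⟨fun b y => b && decide (y.2 ∈ D y.1), true, {true}⟩ : DFA (ι × Fin p) Bool).accepts ↔
      ∀ y ∈ x, y.2 ∈ D y.1 := by
  have hfold : ∀ (x : List (ι × Fin p)) (b : Bool),
      List.foldl (fun b y => b && decide (y.2 ∈ D y.1)) b x = true ↔
        (b = true ∧ ∀ y ∈ x, y.2 ∈ D y.1) := by
    intro x
    induction x with
    | nil => intro b; simp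
    | cons y x ih => intro b; simp [ih, and_assoc]
  rw [DFA.mem_accepts]
  change List.foldl (fun b y => b && decide (y.2 ∈ D y.1)) true x ∈ ({true} : Set Bool) ↔
    ∀ y ∈ x, y.2 ∈ D y.1
  rw [Set.mem_singleton_iff, hfold]
  simp

/-- **Letterwise languages are regular** (they are, by definition here, accepted by a two-state
DFA). [folklore] -/
theorem isRegular_letterwise {ι : Type*} {p : ℕ} (D : ι → Finset (Fin p)) :
    (⟨fun b y => b && decide (y.2 ∈ D y.1), true, {true}⟩ :
      DFA (ι × Fin p) Bool).accepts.IsRegular :=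
  ⟨Bool, inferInstance, _, rfl⟩

/-- The digit words `a` whose zip with the index word `w` lies in the letterwise language of `D`
are exactly the box `∏_j D (w j)` (for any decidability instance on the filter). [folklore] -/
theorem filter_ofFn_mem_letterwise {ι : Type*} {p : ℕ} (D : ι → Finset (Fin p)) {k : ℕ}
    (w : Fin k → ι)
    {inst : DecidablePred fun a : Fin k → Fin p => List.ofFn (fun j => (w j, a j)) ∈
      (⟨fun b y => b && decide (y.2 ∈ D y.1), true, {true}⟩ : DFA (ι × Fin p) Bool).accepts} :
    @Finset.filter _ (fun a : Fin k → Fin p => List.ofFn (fun j => (w j, a j)) ∈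
      (⟨fun b y => b && decide (y.2 ∈ D y.1), true, {true}⟩ : DFA (ι × Fin p) Bool).accepts)
      inst univ = Fintype.piFinset fun j => D (w j) := by
  ext a
  simp only [mem_filter, mem_univ, true_and, Fintype.mem_piFinset, mem_accepts_letterwise,
    List.forall_mem_ofFn_iff]

/-- **Blocks of a letterwise language are digit boxes**: at scale `k` and index word `w`, the block
(`automaticBlock`) of the letterwise language of `D` is the image of the box `∏_j D (w j)` under
the base-`p` value map `a ↦ [a]_p` into `ℤ/(p^k)`. [folklore] -/
theorem automaticBlock_letterwise {ι : Type*} {p : ℕ} (D : ι → Finset (Fin p)) (k : ℕ)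
    (w : Fin k → ι) :
    automaticBlock p k
      (⟨fun b y => b && decide (y.2 ∈ D y.1), true, {true}⟩ : DFA (ι × Fin p) Bool).accepts w =
      (Fintype.piFinset fun j => D (w j)).image
        fun a : Fin k → Fin p => (digitValue a : ZMod (p ^ k)) := by
  rw [automaticBlock_def, filter_ofFn_mem_letterwise]

/-! ### From a digit design to an all-scales regular family -/

/-- **Digit designs lift to all scales.** If digit sets `(D^A_i, D^B_i, D^C_i)_{i ∈ ι}` in `Fin p`
(`p ≥ 2`) form an STPP family in `ℤ/p` of mass `∑ᵢ |D^A_i||D^B_i||D^C_i| > p`, then the three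
letterwise languages are regular, their family of blocks is STPP in `ℤ/(p^k)` at every scale `k`
(carry induction, `digits_eq_of_pow_dvd`), and its mass `(∑ᵢ |D^A_i||D^B_i||D^C_i|)^k` exceeds
`p^k` at every scale `k ≥ 1`. [folklore] -/
theorem allScales_of_digitDesign {ι : Type} [Fintype ι] {p : ℕ} (hp : 2 ≤ p)
    (DA DB DC : ι → Finset (Fin p))
    (hD : AddSimultaneousTPP
      (fun i => (DA i).image fun d : Fin p => ((d : ℕ) : ZMod p))
      (fun i => (DB i).image fun d : Fin p => ((d : ℕ) : ZMod p))
      (fun i => (DC i).image fun d : Fin p => ((d : ℕ) : ZMod p)))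
    (hmass : p < ∑ i, (DA i).card * (DB i).card * (DC i).card) :
    ∃ LA LB LC : Language (ι × Fin p), LA.IsRegular ∧ LB.IsRegular ∧ LC.IsRegular ∧
      (∀ k : ℕ, AddSimultaneousTPP (automaticBlock p k LA) (automaticBlock p k LB)
        (automaticBlock p k LC)) ∧
      ∀ k₀ : ℕ, ∃ k ≥ k₀, p ^ k < ∑ w : Fin k → ι,
        (automaticBlock p k LA w).card * (automaticBlock p k LB w).card *
          (automaticBlock p k LC w).card := by
  haveI : NeZero p := ⟨by omega⟩
  refine ⟨(⟨fun b y => b && decide (y.2 ∈ DA y.1), true, {true}⟩ : DFA (ι × Fin p) Bool).accepts,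
    (⟨fun b y => b && decide (y.2 ∈ DB y.1), true, {true}⟩ : DFA (ι × Fin p) Bool).accepts,
    (⟨fun b y => b && decide (y.2 ∈ DC y.1), true, {true}⟩ : DFA (ι × Fin p) Bool).accepts,
    isRegular_letterwise DA, isRegular_letterwise DB, isRegular_letterwise DC, ?_⟩
  refine ⟨fun k => ?_, fun k₀ => ⟨k₀ + 1, Nat.le_succ _, ?_⟩⟩
  · haveI : NeZero (p ^ k) := ⟨pow_ne_zero _ (NeZero.ne p)⟩
    rw [addSimultaneousTPP_iff_forall]
    intro I J K s hs s' hs' t ht t' ht' u hu u' hu' h0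
    simp only [automaticBlock_letterwise, mem_image, Fintype.mem_piFinset] at hs hs' ht ht' hu hu'
    obtain ⟨S, hS, rfl⟩ := hs
    obtain ⟨S', hS', rfl⟩ := hs'
    obtain ⟨T, hT, rfl⟩ := ht
    obtain ⟨T', hT', rfl⟩ := ht'
    obtain ⟨U, hU, rfl⟩ := hu
    obtain ⟨U', hU', rfl⟩ := hu'
    rw [stppSum_eq_intCast, ZMod.intCast_zmod_eq_zero_iff_dvd, Nat.cast_pow] at h0
    obtain ⟨hIJ, hJK, hSS, hTT, hUU⟩ :=
      digits_eq_of_pow_dvd DA DB DC hD k I J K S S' T T' U U' hS hS' hT hT' hU hU' h0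
    exact ⟨hIJ, hJK, by rw [hSS], by rw [hTT], by rw [hUU]⟩
  · simp only [automaticBlock_letterwise,
      card_image_of_injective _ (natCast_digitValue_injective p (k₀ + 1)),
      Fintype.card_piFinset, ← prod_mul_distrib]
    calc p ^ (k₀ + 1) < (∑ i, (DA i).card * (DB i).card * (DC i).card) ^ (k₀ + 1) :=
          Nat.pow_lt_pow_left hmass (Nat.succ_ne_zero _)
      _ = _ := by rw [Finset.sum_pow', Fintype.piFinset_univ]

/-! ### The digit design in `ℤ/140` -/

/-- **A digit design of mass `144` in `ℤ/140`.** There are digit sets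
`(D^A_i, D^B_i, D^C_i)_{i ∈ Fin 2}` in `Fin 140` whose images in `ℤ/140` form an STPP family of mass
`∑ᵢ |D^A_i||D^B_i||D^C_i| = 3·4·6 + 4·6·3 = 144 > 140`: the CKSU two-triple design
(`addSimultaneousTPP_coordDesign`) in `ℤ/4 × ℤ/5 × ℤ/7`, transported to `ℤ/140` along the Chinese
remainder isomorphism (a sum-reflecting map). [cite: CohnKleinbergSzegedyUmans2005, §5] -/
theorem exists_digitDesign : ∃ DA DB DC : Fin 2 → Finset (Fin 140),
    AddSimultaneousTPP
      (fun i => (DA i).image fun d : Fin 140 => ((d : ℕ) : ZMod 140))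
      (fun i => (DB i).image fun d : Fin 140 => ((d : ℕ) : ZMod 140))
      (fun i => (DC i).image fun d : Fin 140 => ((d : ℕ) : ZMod 140)) ∧
    140 < ∑ i, (DA i).card * (DB i).card * (DC i).card := by
  -- the Chinese remainder isomorphism `ℤ/140 ≃ ℤ/4 × (ℤ/5 × ℤ/7)`, as a sum-reflecting map
  obtain ⟨φ, hφ⟩ : ∃ φ : ZMod 4 × (ZMod 5 × ZMod 7) → ZMod 140,
      ∀ a b c a' b' c', φ a + φ b + φ c = φ a' + φ b' + φ c' → a + b + c = a' + b' + c' := by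
    have h1 : Nat.Coprime 4 35 := by norm_num
    have h2 : Nat.Coprime 5 7 := by norm_num
    let e : ZMod 140 ≃+ ZMod 4 × (ZMod 5 × ZMod 7) :=
      (ZMod.chineseRemainder h1).toAddEquiv.trans
        (AddEquiv.prodCongr (AddEquiv.refl (ZMod 4)) (ZMod.chineseRemainder h2).toAddEquiv)
    exact ⟨e.symm, fun a b c a' b' c' h => by simpa using congrArg e h⟩
  have hφinj := Literature.Computability.AlgebraicComplexity.injective_of_reflect φ hφ
  -- read the elements of `ℤ/140` as digits `Fin 140`
  obtain ⟨ψ, hψ⟩ : ∃ ψ : ZMod 4 × (ZMod 5 × ZMod 7) → Fin 140,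
      ∀ x, (((ψ x : Fin 140) : ℕ) : ZMod 140) = φ x :=
    ⟨fun x => ⟨(φ x).val, ZMod.val_lt _⟩, fun x => ZMod.natCast_zmod_val (φ x)⟩
  have hψinj : Function.Injective ψ := fun x y h => hφinj (by rw [← hψ x, ← hψ y, h])
  have himg : ∀ s : Finset (ZMod 4 × (ZMod 5 × ZMod 7)),
      (s.image ψ).image (fun d : Fin 140 => ((d : ℕ) : ZMod 140)) = s.image φ := by
    intro s
    rw [Finset.image_image]
    exact Finset.image_congr fun x _ => hψ x
  have design := addSimultaneousTPP_coordDesign (H₁ := ZMod 4) (H₂ := ZMod 5) (H₃ := ZMod 7)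
  refine ⟨fun i => (![(univ.erase 0).image fun x : ZMod 4 => (x, (0 : ZMod 5), (0 : ZMod 7)),
        (univ.erase 0).image fun y : ZMod 5 => ((0 : ZMod 4), y, (0 : ZMod 7))] i).image ψ,
      fun i => (![(univ.erase 0).image fun y : ZMod 5 => ((0 : ZMod 4), y, (0 : ZMod 7)),
        (univ.erase 0).image fun z : ZMod 7 => ((0 : ZMod 4), (0 : ZMod 5), z)] i).image ψ,
      fun i => (![(univ.erase 0).image fun z : ZMod 7 => ((0 : ZMod 4), (0 : ZMod 5), z),
        (univ.erase 0).image fun x : ZMod 4 => (x, (0 : ZMod 5), (0 : ZMod 7))] i).image ψ,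
      ?_, ?_⟩
  · simp only [himg]
    exact Literature.Computability.AlgebraicComplexity.addSimultaneousTPP_image_of_reflect
      design φ hφ
  · have i1 : Function.Injective fun x : ZMod 4 => (x, (0 : ZMod 5), (0 : ZMod 7)) :=
      fun a b h => by simpa using h
    have i2 : Function.Injective fun y : ZMod 5 => ((0 : ZMod 4), y, (0 : ZMod 7)) :=
      fun a b h => by simpa using h
    have i3 : Function.Injective fun z : ZMod 7 => ((0 : ZMod 4), (0 : ZMod 5), z) :=
      fun a b h => by simpa using h
    simp only [Fin.sum_univ_two, Matrix.cons_val_zero, Matrix.cons_val_one,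
      card_image_of_injective _ hψinj, card_image_of_injective _ i1,
      card_image_of_injective _ i2, card_image_of_injective _ i3,
      card_erase_of_mem (mem_univ _), card_univ, ZMod.card]
    norm_num

end NontrivialAllScalesFamily

/-! ### The route item -/

open scoped Classical in
/-- **`NontrivialAllScalesFamily`** (settles `stmt-MatrixMultiplication-7362`; exact route signature
`Summit.MatrixMultiplication.MatrixMultiplication.Theses.AutomaticSTPPDesigns.NontrivialAllScalesFamily`):
with base `p = 140` and index alphabet `ι = Fin 2` there are three regular (letterwise) languages
over `ι × Fin 140` whose all-scales block family is an STPP family (CKSU 2005, Def. 5.1) in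
`ℤ/(140^k)` for every `k`, of mass `144^k > 140^k` at every scale `k ≥ 1` — the CKSU two-triple
design in `ℤ/4 × ℤ/5 × ℤ/7 ≅ ℤ/140` read digit by digit (`NontrivialAllScalesFamily.exists_digitDesign`,
`NontrivialAllScalesFamily.allScales_of_digitDesign`). [cite: CohnKleinbergSzegedyUmans2005, §5] -/
theorem NontrivialAllScalesFamily_proof :
    Summit.MatrixMultiplication.MatrixMultiplication.Theses.AutomaticSTPPDesigns.NontrivialAllScalesFamily := by
  unfold
    Summit.MatrixMultiplication.MatrixMultiplication.Theses.AutomaticSTPPDesigns.NontrivialAllScalesFamily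
  obtain ⟨DA, DB, DC, hD, hmass⟩ := NontrivialAllScalesFamily.exists_digitDesign
  obtain ⟨LA, LB, LC, hA, hB, hC, h⟩ :=
    NontrivialAllScalesFamily.allScales_of_digitDesign (by norm_num) DA DB DC hD hmass
  exact ⟨140, Fin 2, inferInstance, LA, LB, LC, by norm_num, hA, hB, hC, h⟩

end Summit.MatrixMultiplication.MatrixMultiplication.Theorems
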